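import Summits.QuantumFields.YangMills.Theorems.EquipartitionCriticalityEquipartitionPinsProbeRigidityC
import Summits.QuantumFields.YangMills.Theorems.EquipartitionCriticalityEquipartitionPinsProbeRigidityD
import HarnessLib

/-!
# Rigidity of the lattice Maxwell field under the equipartition budget — STUB R `stub_rigidity`

Route `EquipartitionCriticality` of `YangMills`, crux item `stmt-QuantumFields-8760`
(`EquipartitionPinsProbe`), line `Sketch`, STUB R (`stub_rigidity`) of the lead prover: every
probability measure `τ` on `ℝ^D`-valued 2-cochains `Y : ZdPlaquette 4 → Fin D → ℝ` of `ℤ⁴` that is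
a.s. closed, has uniformly bounded second moments with the equipartition budget, and satisfies the
(trigonometric) Stein identity of the lattice Maxwell field IS `curvatureGaussianField 4 D`.

This file: the registered STUB R of the line, `stub_rigidity` (hypotheses: the conclusion of
STUB F5 `stub_factorization`, STUB F6 `stub_cosMoment`, STUB R4 `stub_lineVariance`, STUB R6
`stub_gaussFromCharFun`; conclusion: (T1) ∧ (T2) ∧ (T3) ⇒ `τ = curvatureGaussianField 4 D`), assembled
from parts A–D.
-/

noncomputable section

open MeasureTheory Filter Topology
open scoped BigOperators
open Literature.MathematicalPhysics.QuantumFieldTheory Literature.MathematicalPhysics.QuantumLattice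
open Literature.Probability.LatticeModels

namespace Summit.QuantumFields.YangMills.Theorems.EquipartitionPinsProbe

namespace Rigidity

section Main

variable {D : ℕ} {τ : Measure (ZdPlaquette 4 → Fin D → ℝ)}

/-- The budget hypothesis (T2, second clause) in `if … then … else`-form. -/
theorem budget_ite_of_dite (f : ∀ (i j : Fin 4), i < j → Fin D → ℝ) (B : ℝ)
    (h : (∑ i : Fin 4, ∑ j : Fin 4, ∑ a : Fin D, if hij : i < j then f i j hij a else 0) ≤ B) :
    (∑ i : Fin 4, ∑ j : Fin 4, ∑ a : Fin D,
      if i < j then (if hij : i < j then f i j hij a else 0) else 0) ≤ B := by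
  convert h using 4 with i _ j _ a _
  split_ifs <;> rfl

end Main

end Rigidity

/-- Registered anchor of this file: the budget hypothesis (T2, second clause) in
`if … then … else`-form (see `Rigidity.budget_ite_of_dite`). -/
theorem stub_rigidityBudgetIte :
    ∀ (D : ℕ) (τ : Measure (ZdPlaquette 4 → Fin D → ℝ)) (f : ∀ (i j : Fin 4), i < j → Fin D → ℝ) (B : ℝ),
      (∑ i : Fin 4, ∑ j : Fin 4, ∑ a : Fin D, if hij : i < j then f i j hij a else 0) ≤ B →
      (∑ i : Fin 4, ∑ j : Fin 4, ∑ a : Fin D,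
        if i < j then (if hij : i < j then f i j hij a else 0) else 0) ≤ B :=
  fun _ _ f B h => Rigidity.budget_ite_of_dite f B h

/-- **STUB R — rigidity of the lattice Maxwell field under the equipartition budget** (crux
`stmt-QuantumFields-8760`, line `Sketch`; the identification half of the local free-gluon law).
GIVEN the conclusion of STUB F5 (factorization of `Ψ = e^{Q/2}Φ_τ` through the plane–colour sums),
STUB F6 (second moments from the characteristic function), STUB R4 (line variance) and STUB R6
(Gaussian identification): every probability measure `τ` on `ℝ^D`-valued 2-cochains of `ℤ⁴` with
(T1) closedness, (T2) uniformly bounded second moments and the budget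
`∑_{i<j}∑_a E(Y^a_{(0;i,j)})² ≤ 3D`, (T3) the Stein identity, IS `curvatureGaussianField 4 D`.
Proof: for a plaquette indicator `δ` and the line averages `h_L` (same plane–colour sums) F5 + F6
give `E(Y_p^a)² − ½ = E⟨Y,h_L⟩² − Q(h_L) ≥ −Q(h_L) → 0` (R4), so each of the `6D` origin variances is
`≥ ½`; the budget forces equality (`eq_half_of_budget`), hence `E⟨Y,h_L⟩² = Q(h_L) → 0`; then
`main_identity` gives the Gaussian characteristic functional and R6 concludes. -/
theorem stub_rigidity :
    -- (F5, conclusion)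
    (∀ (D : ℕ) (τ : Measure
        (ZdPlaquette 4 → Fin D → ℝ)),
      IsProbabilityMeasure τ →
      (∀ (p : ZdPlaquette 4) (a : Fin D),
        Integrable (fun Y : ZdPlaquette 4 → Fin D → ℝ => Y p a) τ) →
      (∀ (x : Site 4) (i j k : Fin 4)
          (hij : i < j) (hjk : j < k) (a : Fin D),
        ∀ᵐ Y ∂τ,
          (Y (x + Pi.single i 1, ⟨(j, k), hjk⟩) a - Y (x, ⟨(j, k), hjk⟩) a) -
            (Y (x + Pi.single j 1, ⟨(i, k), hij.trans hjk⟩) a -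
              Y (x, ⟨(i, k), hij.trans hjk⟩) a) +
            (Y (x + Pi.single k 1, ⟨(i, j), hij⟩) a - Y (x, ⟨(i, j), hij⟩) a) = 0) →
      (∃ B : ℝ, ∀ (p : ZdPlaquette 4) (a : Fin D),
          Integrable (fun Y => (Y p a) ^ 2) τ ∧ ∫ Y, (Y p a) ^ 2 ∂τ ≤ B) →
      (∀ (S : Finset (ZdPlaquette 4))
          (E : Finset (ZdEdge 4))
          (h : ZdPlaquette 4 → Fin D → ℝ)
          (α : ZdEdge 4 → Fin D → ℝ),
        (∀ e, e ∉ E → α e = 0) →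
        (∀ p, p ∉ S → ∀ a : Fin D,
          plaquetteCurl (fun e => α e a) p = 0) →
        (∫ Y, Real.cos (∑ p ∈ S, ∑ a : Fin D, h p a * Y p a) *
            (∑ p ∈ S, ∑ a : Fin D,
              plaquetteCurl
                (fun e => α e a) p * Y p a) ∂τ =
          -(∑ p ∈ S, ∑ a : Fin D,
              plaquetteCurl
                (fun e => α e a) p * h p a) *
            ∫ Y, Real.sin (∑ p ∈ S, ∑ a : Fin D, h p a * Y p a) ∂τ) ∧
        (∫ Y, Real.sin (∑ p ∈ S, ∑ a : Fin D, h p a * Y p a) *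
            (∑ p ∈ S, ∑ a : Fin D,
              plaquetteCurl
                (fun e => α e a) p * Y p a) ∂τ =
          (∑ p ∈ S, ∑ a : Fin D,
              plaquetteCurl
                (fun e => α e a) p * h p a) *
            ∫ Y, Real.cos (∑ p ∈ S, ∑ a : Fin D, h p a * Y p a) ∂τ)) →
      ∀ (S : Finset (ZdPlaquette 4))
          (h h' : ZdPlaquette 4 → Fin D → ℝ),
        (∀ (i j : Fin 4) (hij : i < j) (a : Fin D),
          ∑ p ∈ S, (if p.2 = ⟨(i, j), hij⟩ then h p a else 0) =
            ∑ p ∈ S, (if p.2 = ⟨(i, j), hij⟩ then h' p a else 0)) →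
        (Real.exp ((∑ p ∈ S, ∑ q ∈ S, ∑ a : Fin D,
              h p a * h q a * curvatureTwoPoint p q) / 2) *
            ∫ Y, Real.cos (∑ p ∈ S, ∑ a : Fin D, h p a * Y p a) ∂τ =
          Real.exp ((∑ p ∈ S, ∑ q ∈ S, ∑ a : Fin D,
              h' p a * h' q a * curvatureTwoPoint p q) / 2) *
            ∫ Y, Real.cos (∑ p ∈ S, ∑ a : Fin D, h' p a * Y p a) ∂τ) ∧
        (Real.exp ((∑ p ∈ S, ∑ q ∈ S, ∑ a : Fin D,
              h p a * h q a * curvatureTwoPoint p q) / 2) *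
            ∫ Y, Real.sin (∑ p ∈ S, ∑ a : Fin D, h p a * Y p a) ∂τ =
          Real.exp ((∑ p ∈ S, ∑ q ∈ S, ∑ a : Fin D,
              h' p a * h' q a * curvatureTwoPoint p q) / 2) *
            ∫ Y, Real.sin (∑ p ∈ S, ∑ a : Fin D, h' p a * Y p a) ∂τ)) →
    -- (F6)
    (∀ (D : ℕ) (τ : Measure
        (ZdPlaquette 4 → Fin D → ℝ)),
      IsProbabilityMeasure τ →
      (∀ (p : ZdPlaquette 4) (a : Fin D),
        Integrable (fun Y => (Y p a) ^ 2) τ) →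
      ∀ (S : Finset (ZdPlaquette 4))
        (h : ZdPlaquette 4 → Fin D → ℝ),
        Tendsto (fun s : ℝ =>
            (1 - ∫ Y, Real.cos (s * ∑ p ∈ S, ∑ a : Fin D, h p a * Y p a) ∂τ) / s ^ 2)
          (𝓝[≠] 0)
          (𝓝 ((∫ Y, (∑ p ∈ S, ∑ a : Fin D, h p a * Y p a) ^ 2 ∂τ) / 2))) →
    -- (R4)
    (∀ (i j : Fin 4) (hij : i < j),
      Tendsto (fun L : ℕ =>
          (∑ s ∈ Finset.range L, ∑ t ∈ Finset.range L,
            curvatureTwoPoint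
              ((Pi.single (0 : Fin 4) (s : ℤ) : Site 4), ⟨(i, j), hij⟩)
              ((Pi.single (0 : Fin 4) (t : ℤ) : Site 4), ⟨(i, j), hij⟩)) /
            ((L : ℝ) ^ 2))
        atTop (𝓝 0)) →
    -- (R6)
    (∀ (D : ℕ) (τ : Measure
        (ZdPlaquette 4 → Fin D → ℝ)),
      IsProbabilityMeasure τ →
      (∀ (S : Finset (ZdPlaquette 4))
          (h : ZdPlaquette 4 → Fin D → ℝ),
        (∫ Y, Real.cos (∑ p ∈ S, ∑ a : Fin D, h p a * Y p a) ∂τ =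
          Real.exp (-(∑ p ∈ S, ∑ q ∈ S, ∑ a : Fin D,
            h p a * h q a * curvatureTwoPoint p q) / 2)) ∧
        (∫ Y, Real.sin (∑ p ∈ S, ∑ a : Fin D, h p a * Y p a) ∂τ = 0)) →
      τ = curvatureGaussianField 4 D) →
    -- (R)
    ∀ (D : ℕ) (τ : Measure
        (ZdPlaquette 4 → Fin D → ℝ)),
      IsProbabilityMeasure τ →
      (∀ (x : Site 4) (i j k : Fin 4)
          (hij : i < j) (hjk : j < k) (a : Fin D),
        ∀ᵐ Y ∂τ,
          (Y (x + Pi.single i 1, ⟨(j, k), hjk⟩) a - Y (x, ⟨(j, k), hjk⟩) a) -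
            (Y (x + Pi.single j 1, ⟨(i, k), hij.trans hjk⟩) a -
              Y (x, ⟨(i, k), hij.trans hjk⟩) a) +
            (Y (x + Pi.single k 1, ⟨(i, j), hij⟩) a - Y (x, ⟨(i, j), hij⟩) a) = 0) →
      ((∃ B : ℝ, ∀ (p : ZdPlaquette 4) (a : Fin D),
          Integrable (fun Y => (Y p a) ^ 2) τ ∧ ∫ Y, (Y p a) ^ 2 ∂τ ≤ B) ∧
        (∑ i : Fin 4, ∑ j : Fin 4, ∑ a : Fin D,
          if hij : i < j then ∫ Y, (Y ((0 : Site 4),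
            ⟨(i, j), hij⟩) a) ^ 2 ∂τ else 0) ≤ 3 * D) →
      (∀ (S : Finset (ZdPlaquette 4))
          (E : Finset (ZdEdge 4))
          (h : ZdPlaquette 4 → Fin D → ℝ)
          (α : ZdEdge 4 → Fin D → ℝ),
        (∀ e, e ∉ E → α e = 0) →
        (∀ p, p ∉ S → ∀ a : Fin D,
          plaquetteCurl (fun e => α e a) p = 0) →
        (∫ Y, Real.cos (∑ p ∈ S, ∑ a : Fin D, h p a * Y p a) *
            (∑ p ∈ S, ∑ a : Fin D,
              plaquetteCurl
                (fun e => α e a) p * Y p a) ∂τ =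
          -(∑ p ∈ S, ∑ a : Fin D,
              plaquetteCurl
                (fun e => α e a) p * h p a) *
            ∫ Y, Real.sin (∑ p ∈ S, ∑ a : Fin D, h p a * Y p a) ∂τ) ∧
        (∫ Y, Real.sin (∑ p ∈ S, ∑ a : Fin D, h p a * Y p a) *
            (∑ p ∈ S, ∑ a : Fin D,
              plaquetteCurl
                (fun e => α e a) p * Y p a) ∂τ =
          (∑ p ∈ S, ∑ a : Fin D,
              plaquetteCurl
                (fun e => α e a) p * h p a) *
            ∫ Y, Real.cos (∑ p ∈ S, ∑ a : Fin D, h p a * Y p a) ∂τ)) →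
      τ = curvatureGaussianField 4 D := by
  intro hF5 hF6 hR4 hR6 D τ hτ hT1 hT2 hT3
  obtain ⟨⟨B, hB⟩, hbudget⟩ := hT2
  have hY : ∀ (p : ZdPlaquette 4) (a : Fin D), Integrable (fun Y => (Y p a) ^ 2) τ :=
    fun p a => (hB p a).1
  have hYi : ∀ (p : ZdPlaquette 4) (a : Fin D),
      Integrable (fun Y : ZdPlaquette 4 → Fin D → ℝ => Y p a) τ :=
    fun p a => Rigidity.integrable_eval hY p a
  have hF5τ := hF5 D τ hτ hYi hT1 ⟨B, hB⟩ hT3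
  have hF6τ := hF6 D τ hτ hY
  -- the line defects and the half-variance
  have hdef := fun (i j : Fin 4) (hij : i < j) (a : Fin D) (L : ℕ) =>
    Rigidity.line_defect hF5τ hF6τ i j hij a L
  have hq : ∀ (i j : Fin 4) (hij : i < j),
      Tendsto (fun L : ℕ => (∑ s ∈ Finset.range (L + 1), ∑ t ∈ Finset.range (L + 1),
          curvatureTwoPoint ((Pi.single (0 : Fin 4) (s : ℤ) : Site 4), ⟨(i, j), hij⟩)
            ((Pi.single (0 : Fin 4) (t : ℤ) : Site 4), ⟨(i, j), hij⟩)) / (((L + 1 : ℕ) : ℝ) ^ 2))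
        atTop (𝓝 0) :=
    fun i j hij => (hR4 i j hij).comp (tendsto_add_atTop_nat 1)
  have hhalf : ∀ (i j : Fin 4) (hij : i < j) (a : Fin D),
      (∫ Y, (Y ((0 : Site 4), ⟨(i, j), hij⟩) a) ^ 2 ∂τ) = 1 / 2 := by
    have key := Rigidity.eq_half_of_budget
      (fun i j a => if hij : i < j then ∫ Y, (Y ((0 : Site 4), ⟨(i, j), hij⟩) a) ^ 2 ∂τ else 0)
      ?_ (Rigidity.budget_ite_of_dite _ _ hbudget)
    · intro i j hij a
      have := key i j hij a
      simpa [hij] using this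
    · intro i j hij a
      simp only [hij, dif_pos]
      -- lower bound from the line defects
      have hge : ∀ L : ℕ, -((∑ s ∈ Finset.range (L + 1), ∑ t ∈ Finset.range (L + 1),
          curvatureTwoPoint ((Pi.single (0 : Fin 4) (s : ℤ) : Site 4), ⟨(i, j), hij⟩)
            ((Pi.single (0 : Fin 4) (t : ℤ) : Site 4), ⟨(i, j), hij⟩)) / (((L + 1 : ℕ) : ℝ) ^ 2)) ≤
          (∫ Y, (Y ((0 : Site 4), ⟨(i, j), hij⟩) a) ^ 2 ∂τ) - 1 / 2 := by
        intro L
        have h1 := hdef i j hij a L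
        have h2 : 0 ≤ ∫ Y, ((∑ t ∈ Finset.range (L + 1),
            Y ((Pi.single (0 : Fin 4) (t : ℤ) : Site 4), ⟨(i, j), hij⟩) a) / ((L + 1 : ℕ) : ℝ)) ^ 2 ∂τ :=
          integral_nonneg fun Y => sq_nonneg _
        linarith
      have hlim := (hq i j hij).neg
      rw [neg_zero] at hlim
      have := le_of_tendsto' hlim hge
      linarith
  have hline : ∀ (i j : Fin 4) (hij : i < j) (a : Fin D),
      Tendsto (fun L : ℕ => ∫ Y, ((∑ t ∈ Finset.range (L + 1),
          Y ((Pi.single (0 : Fin 4) (t : ℤ) : Site 4), ⟨(i, j), hij⟩) a) / ((L + 1 : ℕ) : ℝ)) ^ 2 ∂τ)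
        atTop (𝓝 0) := by
    intro i j hij a
    refine (hq i j hij).congr fun L => ?_
    have h1 := hdef i j hij a L
    rw [hhalf i j hij a] at h1
    linarith
  haveI := hτ
  exact hR6 D τ hτ (Rigidity.main_identity hY hF5τ hline hq)

end Summit.QuantumFields.YangMills.Theorems.EquipartitionPinsProbe

end
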